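import Mathlib
import HarnessLib
import Literature.Computability.AlgebraicComplexity.StandardFamiliesProofs
import Literature.Computability.AlgebraicComplexity.SymbolicMatrixDecomposition
import Literature.Computability.AlgebraicComplexity.LRPencilOfMatrix
import Summits.ValiantsHypothesis.ValiantsHypothesis.Theorems.ChowBorderDepth3LocalFanInTwoNewton

/-!
# Stub `stub_esymNormalForm` (N) of line `registered` — elementary-symmetric normal form

Crux `SummationBits.RyserOptimalDepth3` (stmt-ValiantsHypothesis-7565; route
`ValiantsHypothesis/SummationBits`), line `registered` (birth "degree dial"), registered stub N,
proved with exactly the registered signature (`stub_esymNormalForm`).  An affine depth-three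
expression `per_n = Σ_{i<r} Π_{j<D} ℓ_ij` over `ℂ` (`ℓ_ij` of total degree `≤ 1`) yields scalars
`a_i` and degree-one-homogeneous `m_ij` with `Σ_{i<r} a_i · e_n(m_i1, …, m_iD) = per_n` — the SAME
`r` and `D` (Shpilka's symmetric model of depth three).

Proof.
* GENERIC POINT (`exists_eval_ne_zero`): `ℂ` is infinite, so the product of the non-zero factors
  `ℓ_ij` (non-zero in the domain `ℂ[x]`) does not vanish identically (`MvPolynomial.funext`):
  there is `u ∈ ℂ^(n×n)` with `ℓ_ij(u) ≠ 0` for every non-zero `ℓ_ij`.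
* TRANSLATION `T = aeval (x_v ↦ x_v + u_v)`: for affine `ℓ`,
  `T ℓ = C (ℓ(u)) + L(ℓ)` with the linear part `L(ℓ) = Σ_v coeff_{e_v}(ℓ) · x_v`, homogeneous of
  degree one (`aeval_translate_eq`, from `LRPencil.eq_affine_of_totalDegree_le_one`).
* PER SUMMAND (`homogeneousComponent_prod_translate`): with `a_i = Π_j ℓ_ij(u)` and
  `m_ij = ℓ_ij(u)⁻¹ · L(ℓ_ij)`: if every `ℓ_ij ≠ 0` then
  `Π_j T ℓ_ij = C a_i · Π_j (1 + m_ij)` whose degree-`k` component is `C a_i · e_k(m_i)`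
  (`ChowBorderDepth3LocalFanInTwo.homogeneousComponent_prod_one_add`); if some `ℓ_ij = 0` both
  sides vanish (`a_i = 0`).
* TOP COMPONENT (`homogeneousComponent_translate_perPoly`): `per_n` is homogeneous of degree `n`
  (`perPoly_isHomogeneous`) and translation keeps the top homogeneous component
  (`weightedHomogeneousComponent_translate`), so `H_n[T per_n] = per_n`.
* ASSEMBLY: apply `H_n ∘ T` to `Σ_i Π_j ℓ_ij = per_n`.

Tree facts used (all proved): `perPoly_isHomogeneous`, `weightedHomogeneousComponent_translate`,
`LRPencil.eq_affine_of_totalDegree_le_one`,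
`ChowBorderDepth3LocalFanInTwo.homogeneousComponent_prod_one_add`.  Mathlib otherwise; no named
facts, no `def`s.  The hypothesis `1 ≤ n` of the registered signature is not needed.
[cite: Shpilka2002, symmetric model of depth three]
-/

-- Sub = Summit layout; duplicated namespace component intended
set_option linter.dupNamespace false

noncomputable section

namespace Summit.ValiantsHypothesis.ValiantsHypothesis.Theorems.SummationBitsRyserOptimalDepth3

open MvPolynomial
open Literature.Computability.AlgebraicComplexity
open scoped BigOperators

namespace StubEsymNormalForm

variable {σ : Type*}

/-- **Generic point**: for a finite family of polynomials over `ℂ` there is a point at which every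
non-zero member of the family is non-zero (the product of the non-zero members is a non-zero
polynomial, hence not identically zero on the infinite field `ℂ`). [folklore] -/
theorem exists_eval_ne_zero {ι : Type*} [Fintype ι] (p : ι → MvPolynomial σ ℂ) :
    ∃ u : σ → ℂ, ∀ i, p i ≠ 0 → eval u (p i) ≠ 0 := by
  classical
  have hPne : (∏ i, (if p i = 0 then 1 else p i) : MvPolynomial σ ℂ) ≠ 0 :=
    Finset.prod_ne_zero_iff.2 fun i _ => by
      split_ifs with h
      · exact one_ne_zero
      · exact h
  obtain ⟨u, hu⟩ : ∃ u : σ → ℂ, eval u (∏ i, (if p i = 0 then 1 else p i)) ≠ 0 := by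
    by_contra hcon
    push Not at hcon
    exact hPne (MvPolynomial.funext fun x => by rw [hcon x, map_zero])
  refine ⟨u, fun i hi => ?_⟩
  rw [map_prod] at hu
  have h := Finset.prod_ne_zero_iff.1 hu i (Finset.mem_univ _)
  rwa [if_neg hi] at h

variable [Fintype σ]

/-- The linear part `Σ_v coeff_{e_v}(p) · x_v` of a polynomial is homogeneous of degree one.
[folklore] -/
theorem isHomogeneous_linearPart {R : Type*} [CommSemiring R] (p : MvPolynomial σ R) :
    (∑ v, C (coeff (Finsupp.single v 1) p) * X v : MvPolynomial σ R).IsHomogeneous 1 :=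
  IsHomogeneous.sum _ _ _ fun _ _ => isHomogeneous_C_mul_X _ _

/-- **Translating an affine polynomial**: if `deg ℓ ≤ 1` then
`ℓ(x + u) = C (ℓ(u)) + Σ_v coeff_{e_v}(ℓ) · x_v`. [folklore] -/
theorem aeval_translate_eq (u : σ → ℂ) (p : MvPolynomial σ ℂ) (hp : p.totalDegree ≤ 1) :
    aeval (fun v => X v + C (u v)) p =
      C (eval u p) + ∑ v, C (coeff (Finsupp.single v 1) p) * X v := by
  have h := LRPencil.eq_affine_of_totalDegree_le_one p hp
  have he : eval u p = coeff 0 p + ∑ v, coeff (Finsupp.single v 1) p * u v := by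
    conv_lhs => rw [h]
    simp only [map_add, map_sum, map_mul, eval_C, eval_X]
  conv_lhs => rw [h]
  rw [he]
  simp only [map_add, map_sum, map_mul, aeval_C, aeval_X, algebraMap_eq, mul_add,
    Finset.sum_add_distrib]
  ring

/-- **Per-summand identity**: if `u` is a point with `ℓ_j(u) ≠ 0` for every non-zero affine
factor `ℓ_j`, then the degree-`k` homogeneous component of `Π_j ℓ_j(x + u)` is
`C (Π_j ℓ_j(u)) · e_k(m)` with `m_j = ℓ_j(u)⁻¹ · (linear part of ℓ_j)`; both sides vanish when
some `ℓ_j = 0`. [folklore] -/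
theorem homogeneousComponent_prod_translate (u : σ → ℂ) {D : ℕ} (ℓ : Fin D → MvPolynomial σ ℂ)
    (hℓ : ∀ j, (ℓ j).totalDegree ≤ 1) (hu : ∀ j, ℓ j ≠ 0 → eval u (ℓ j) ≠ 0) (k : ℕ) :
    homogeneousComponent k (∏ j, aeval (fun v => X v + C (u v)) (ℓ j)) =
      C (∏ j, eval u (ℓ j)) *
        aeval (fun j => C (eval u (ℓ j))⁻¹ * ∑ v, C (coeff (Finsupp.single v 1) (ℓ j)) * X v)
          (esymm (Fin D) ℂ k) := by
  classical
  by_cases h : ∀ j, ℓ j ≠ 0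
  · -- every factor is non-zero, hence has a non-zero constant term after translation
    have hc : ∀ j, eval u (ℓ j) ≠ 0 := fun j => hu j (h j)
    have hfac : ∀ j, aeval (fun v => X v + C (u v)) (ℓ j) =
        C (eval u (ℓ j)) *
          (1 + C (eval u (ℓ j))⁻¹ * ∑ v, C (coeff (Finsupp.single v 1) (ℓ j)) * X v) := by
      intro j
      rw [aeval_translate_eq u (ℓ j) (hℓ j), mul_add, mul_one, ← mul_assoc, ← C_mul,
        mul_inv_cancel₀ (hc j), C_1, one_mul]
    rw [Finset.prod_congr rfl (fun j _ => hfac j), Finset.prod_mul_distrib, ← map_prod C,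
      homogeneousComponent_C_mul,
      ChowBorderDepth3LocalFanInTwo.homogeneousComponent_prod_one_add
        (fun j => C (eval u (ℓ j))⁻¹ * ∑ v, C (coeff (Finsupp.single v 1) (ℓ j)) * X v)
        (fun j => (isHomogeneous_linearPart (ℓ j)).C_mul _) k]
  · -- some factor vanishes: both sides are zero
    push Not at h
    obtain ⟨j, hj⟩ := h
    have h1 : (∏ j, aeval (fun v => X v + C (u v)) (ℓ j)) = 0 :=
      Finset.prod_eq_zero (Finset.mem_univ j) (by rw [hj, map_zero])
    have h2 : (∏ j, eval u (ℓ j)) = 0 :=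
      Finset.prod_eq_zero (Finset.mem_univ j) (by rw [hj, map_zero])
    rw [h1, h2, map_zero, C_0, zero_mul]

/-- **The top homogeneous component of the translated permanent is the permanent**:
`H_n[per_n(x + u)] = per_n` (`per_n` is homogeneous of degree `n`; translation preserves the top
component). [folklore] -/
theorem homogeneousComponent_translate_perPoly (n : ℕ) (u : Fin n × Fin n → ℂ) :
    homogeneousComponent n (aeval (fun v => X v + C (u v)) (perPoly (Fin n) ℂ)) =
      perPoly (Fin n) ℂ := by
  have hhom : (perPoly (Fin n) ℂ).IsHomogeneous n := by
    simpa using (perPoly_isHomogeneous (n := Fin n) (k := ℂ))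
  have h := weightedHomogeneousComponent_translate (σ := Fin n × Fin n) (1 : Fin n × Fin n → ℕ)
    (AddMonoidHom.id ℕ) (fun _ => rfl) u hhom
  rw [aeval_eq_eval₂Hom, algebraMap_eq]
  exact h

end StubEsymNormalForm

/-- **Stub N (registered) — ELEMENTARY-SYMMETRIC NORMAL FORM**: for `n ≥ 1`, an affine expression
`per_n = Σ_{i<r} Π_{j<D} ℓ_ij` yields scalars `a_i` and degree-1-homogeneous `m_ij` with
`Σ_i a_i · e_n(m_i1, …, m_iD) = per_n` (same `r`, same `D`).  Generic translation `x ↦ x + u` (all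
non-zero factors get a non-zero constant term), division by the constant terms, degree-`n`
homogeneous component (`homogeneousComponent_prod_one_add`; the top component of `per_n(x+u)` is
`per_n`). [cite: Shpilka2002, symmetric model of depth three] -/
theorem stub_esymNormalForm :
    ∀ n : ℕ, 1 ≤ n →
      ∀ (r D : ℕ) (ℓ : Fin r → Fin D → MvPolynomial (Fin n × Fin n) ℂ),
        (∀ i j, (ℓ i j).totalDegree ≤ 1) → (∑ i, ∏ j, ℓ i j) = perPoly (Fin n) ℂ →
          ∃ (a : Fin r → ℂ) (m : Fin r → Fin D → MvPolynomial (Fin n × Fin n) ℂ),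
            (∀ i j, (m i j).IsHomogeneous 1) ∧
              (∑ i, C (a i) * aeval (m i) (esymm (Fin D) ℂ n)) = perPoly (Fin n) ℂ := by
  intro n _hn r D ℓ hℓ hsum
  obtain ⟨u, hu⟩ :=
    StubEsymNormalForm.exists_eval_ne_zero (fun ij : Fin r × Fin D => ℓ ij.1 ij.2)
  refine ⟨fun i => ∏ j, eval u (ℓ i j),
    fun i j => C (eval u (ℓ i j))⁻¹ * ∑ v, C (coeff (Finsupp.single v 1) (ℓ i j)) * X v,
    fun i j => (StubEsymNormalForm.isHomogeneous_linearPart (ℓ i j)).C_mul _, ?_⟩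
  -- translate the given expression by `u` and take the degree-`n` homogeneous component
  have key := congrArg (fun p => homogeneousComponent n (aeval (fun v => X v + C (u v)) p)) hsum
  simp only [map_sum, map_prod, StubEsymNormalForm.homogeneousComponent_translate_perPoly] at key
  rw [← key]
  refine Finset.sum_congr rfl fun i _ => ?_
  exact (StubEsymNormalForm.homogeneousComponent_prod_translate u (ℓ i) (hℓ i)
    (fun j => hu (i, j)) n).symm

end Summit.ValiantsHypothesis.ValiantsHypothesis.Theorems.SummationBitsRyserOptimalDepth3

end
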